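import Summits.CriticalPhenomena.SAWScalingLimit.Theorems.SAWLoopFugacityFlowSimpleSubseqLimitsStubPassage
import HarnessLib

/-!
# Boundary typing of the BOUNDARY clause of the crux `SimpleSubseqLimits` — vocabulary, openness,
# limit passage and closing
(crux stmt-CriticalPhenomena-4982, decl `Summit.CriticalPhenomena.SAWScalingLimit.Theses.SAWLoopFugacityFlow.SimpleSubseqLimits`;
line lead c3, reshaping v3 of line `past-shadowing-costs-halves` = the A-side-free lattice line, 2026-08-16)

The three earlier lines of this crux took the boundary clause `range ∩ ∂D ⊆ {a, b}` of the crux from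
SHAPE, i.e. from the open A-side crux `AvoidanceLimit` (stmt-10649) through `AvoidancePassage` and
`SLEAvoidanceValue`. Here it is typed on the lattice, as the "no boundary crawling" bound named in the
crux's why-might-fail:

* `NearBoundaryVisit D γ ρ ε` — at some time the curve is `ε`-close to `∂D` (`infDist < ε`) and `ρ`-far
  from both marked points; `nearBoundaryVisitEvent D ρ ε` its saturation in `CurveClass ℂ`;
* `BoundaryDecayAt D a b` — for all `ρ, θ > 0` there is `ε > 0` with, eventually as `δ → 0⁺`,
  `P_δ[curve ∈ nearBoundaryVisitEvent D ρ ε] ≤ θ`; `BoundaryDecay` — along every endpoint approximation.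

Results (namespace `…Theorems.SimpleSubseqLimits.Boundary.Passage`):
* `isOpen_setOf_nearBoundaryVisit` (registered stub `stub_boundaryOpen`, statement inlined),
  `isOpen_nearBoundaryVisitEvent` — the thickened configuration is OPEN (strict inequalities,
  `1`-Lipschitz `infDist`, reparametrisation transport `Curve.exists_dist_reparam_lt`);
* `boundaryTouch_null` — LIMIT PASSAGE: `BoundaryDecayAt` + weak convergence along `s n → 0⁺` ⇒ the
  exact event "the trace meets `∂D` at a point `ρ`-far from `a, b`" is `ν`-null (it lies in every
  thickened event; open-set portmanteau `Passage.measure_image_mk_le_limsup_law`);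
* `ae_boundary_of_boundaryDecayAt` (registered stub `stub_boundaryPassage`) — hence `ν`-a.e.
  `range ∩ ∂D ⊆ {D.pt 0, D.pt 1}` (countably many `ρ = 1/(k+1)`).
No SHAPE / A-side input is used. The composition with the first-hit typing of ORDER and the pins are
`Theorems/SAWLoopFugacityFlowSimpleSubseqLimitsLatticeLine.lean`.
-/

noncomputable section

open MeasureTheory Filter Topology Set Metric Function
open Literature.Probability.RandomPlanarGeometry Literature.Probability.LatticeModels
open scoped ENNReal NNReal BoundedContinuousFunction unitInterval

namespace Summit.CriticalPhenomena.SAWScalingLimit.Theorems.SimpleSubseqLimits.Boundary.Passage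

open Summit.CriticalPhenomena.SAWScalingLimit.Theorems.SimpleSubseqLimits.Negative (WeakLimitAlong)
open Summit.CriticalPhenomena.SAWScalingLimit.Theorems.SimpleSubseqLimits.MarkedPointRevisit.Passage
  (latticeCurve mk_mem_image_mk_iff measure_image_mk_le_limsup_law IsSubseqLimit)

/-! ### Vocabulary -/

/-- **Near-boundary visit away from the marked points**: at some time the curve is `ε`-close to
`∂D` (open thickening, `infDist < ε`) and `ρ`-far from both marked points `D.pt 0`, `D.pt 1`. Strict
inequalities: an OPEN, reparametrisation-invariant configuration, visible on the lattice polyline.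
[folklore] -/
def NearBoundaryVisit (D : DobrushinDomain) (γ : Curve ℂ) (ρ ε : ℝ) : Prop :=
  ∃ t : I, infDist (γ t) (frontier D.carrier) < ε ∧ ρ < dist (γ t) (D.pt 0) ∧ ρ < dist (γ t) (D.pt 1)

/-- The event "some representative has a near-boundary visit at `(ρ, ε)`". [folklore] -/
def nearBoundaryVisitEvent (D : DobrushinDomain) (ρ ε : ℝ) : Set (CurveClass ℂ) :=
  {c | ∃ γ : Curve ℂ, CurveClass.mk γ = c ∧ NearBoundaryVisit D γ ρ ε}

/-- **Boundary decay at `(D; a_δ, b_δ)`** (the lattice typing of the crux's BOUNDARY clause, "no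
boundary crawling"): for every separation `ρ > 0` and target `θ > 0` there is a width `ε > 0` such
that for all small meshes the critical SAW law charges the near-boundary-visit event at most `θ`. An
unconditional probability of an OPEN event of the curve class of the walk; implied by the summit
conjecture and necessary for the crux given `EventualTight` (`Boundary.Line`). Lattice mechanism it
asks for: boundary repulsion of the critical two-point SAW in `Ω_δ` away from its endpoints, uniformly
in the mesh (boundary exponent; nothing in print at `x_c`). [folklore] -/
def BoundaryDecayAt (D : DobrushinDomain) (a b : ℝ → Site 2) : Prop :=
  ∀ ρ θ : ℝ, 0 < ρ → 0 < θ → ∃ ε : ℝ, 0 < ε ∧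
    ∀ᶠ δ in 𝓝[>] (0 : ℝ),
      SAW.law D.carrier δ (a δ) (b δ) {γ | γ.curve ∈ nearBoundaryVisitEvent D ρ ε} ≤ ENNReal.ofReal θ

/-- Boundary decay along EVERY endpoint approximation (an open statement of this crux, the lattice
typing of its BOUNDARY clause — deliberately untagged: it is not a literature fact). -/
def BoundaryDecay : Prop :=
  ∀ (D : DobrushinDomain) (a b : ℝ → Site 2), SAW.IsEndpointApprox D a b → BoundaryDecayAt D a b

/-! ### Step 1: the thickened configuration is open -/

/-- **Openness of the near-boundary-visit configuration** (registered stub `stub_boundaryOpen` of the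
crux item, statement inlined) for the reparametrisation pseudo-distance on `Curve ℂ`: fix a witnessing
time `t` for `γ`; the three strict inequalities have a least slack `2d > 0`; a curve `γ'` at distance
`< d` has a reparametrisation `φ` with `γ' ∘ φ` uniformly `d`-close to `γ` (`Curve.exists_dist_reparam_lt`),
and `φ t` witnesses the configuration for `γ'` (`infDist` and `dist` are `1`-Lipschitz). [folklore] -/
theorem stub_boundaryOpen : ∀ (D : DobrushinDomain) (ρ ε : ℝ), IsOpen {γ : Curve ℂ | ∃ t : I, Metric.infDist (γ t) (frontier D.carrier) < ε ∧ ρ < dist (γ t) (D.pt 0) ∧ ρ < dist (γ t) (D.pt 1)} := by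
  intro D ρ ε
  rw [Metric.isOpen_iff]
  rintro γ ⟨t, hfr, h0, h1⟩
  obtain ⟨d, hd0, hd1, hd2, hd3⟩ : ∃ d : ℝ, 0 < d ∧ 2 * d ≤ ε - infDist (γ t) (frontier D.carrier) ∧
      2 * d ≤ dist (γ t) (D.pt 0) - ρ ∧ 2 * d ≤ dist (γ t) (D.pt 1) - ρ := by
    refine ⟨min (ε - infDist (γ t) (frontier D.carrier))
        (min (dist (γ t) (D.pt 0) - ρ) (dist (γ t) (D.pt 1) - ρ)) / 2,
      half_pos (lt_min (sub_pos.2 hfr) (lt_min (sub_pos.2 h0) (sub_pos.2 h1))), ?_, ?_, ?_⟩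
    · linarith [min_le_left (ε - infDist (γ t) (frontier D.carrier))
        (min (dist (γ t) (D.pt 0) - ρ) (dist (γ t) (D.pt 1) - ρ))]
    · linarith [min_le_right (ε - infDist (γ t) (frontier D.carrier))
        (min (dist (γ t) (D.pt 0) - ρ) (dist (γ t) (D.pt 1) - ρ)),
        min_le_left (dist (γ t) (D.pt 0) - ρ) (dist (γ t) (D.pt 1) - ρ)]
    · linarith [min_le_right (ε - infDist (γ t) (frontier D.carrier))
        (min (dist (γ t) (D.pt 0) - ρ) (dist (γ t) (D.pt 1) - ρ)),
        min_le_right (dist (γ t) (D.pt 0) - ρ) (dist (γ t) (D.pt 1) - ρ)]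
  refine ⟨d, hd0, fun γ' hγ' => ?_⟩
  rw [Metric.mem_ball, dist_comm] at hγ'
  obtain ⟨φ, hφ⟩ := Curve.exists_dist_reparam_lt hγ'
  have hcl : dist (γ t) (γ' (φ t)) < d := by
    have h := ContinuousMap.dist_apply_le_dist (f := γ.toContinuousMap)
      (g := (γ'.reparam φ).toContinuousMap) (x := t)
    simp only [Curve.coe_toContinuousMap, Curve.reparam_apply] at h
    exact h.trans_lt hφ
  refine ⟨φ t, ?_, ?_, ?_⟩
  · have h₁ : infDist (γ' (φ t)) (frontier D.carrier) ≤
        infDist (γ t) (frontier D.carrier) + dist (γ' (φ t)) (γ t) :=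
      infDist_le_infDist_add_dist
    rw [dist_comm] at h₁
    linarith
  · have h₁ := dist_triangle (γ t) (γ' (φ t)) (D.pt 0)
    linarith
  · have h₁ := dist_triangle (γ t) (γ' (φ t)) (D.pt 1)
    linarith

/-- The open configuration set is the set of curves with a near-boundary visit (definitional
read-back of the registered statement). [folklore] -/
theorem isOpen_setOf_nearBoundaryVisit (D : DobrushinDomain) (ρ ε : ℝ) :
    IsOpen {γ : Curve ℂ | NearBoundaryVisit D γ ρ ε} :=
  stub_boundaryOpen D ρ ε

/-- The thickened event is the image of the open configuration set under the quotient map.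
[folklore] -/
theorem nearBoundaryVisitEvent_eq_image (D : DobrushinDomain) (ρ ε : ℝ) :
    nearBoundaryVisitEvent D ρ ε = CurveClass.mk '' {γ | NearBoundaryVisit D γ ρ ε} :=
  Set.ext fun _ => exists_congr fun _ => and_comm

/-- **The near-boundary-visit event is open** in `CurveClass ℂ` (`SeparationQuotient.mk` is an open
map). [folklore] -/
theorem isOpen_nearBoundaryVisitEvent (D : DobrushinDomain) (ρ ε : ℝ) :
    IsOpen (nearBoundaryVisitEvent D ρ ε) := by
  rw [nearBoundaryVisitEvent_eq_image]
  exact SeparationQuotient.isOpenMap_mk _ (isOpen_setOf_nearBoundaryVisit D ρ ε)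

/-- The lattice event `{γ | γ.curve ∈ nearBoundaryVisitEvent …}` is the polyline event
`{γ | NearBoundaryVisit D (latticeCurve γ) …}` (open sets of curves are saturated for distance zero).
[folklore] -/
theorem setOf_nearBoundaryVisit_latticeCurve {Ω : Set ℂ} {δ : ℝ} {u v : Site 2}
    (D : DobrushinDomain) (ρ ε : ℝ) :
    {γ : SAW.DomainSAW Ω δ u v | NearBoundaryVisit D (latticeCurve γ) ρ ε} =
      {γ | γ.curve ∈ nearBoundaryVisitEvent D ρ ε} := by
  ext γ
  simp only [mem_setOf_eq, nearBoundaryVisitEvent_eq_image]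
  exact (mk_mem_image_mk_iff (isOpen_setOf_nearBoundaryVisit D ρ ε) (latticeCurve γ)).symm

/-! ### Step 2: exact boundary touches and the limit passage -/

/-- **Exact boundary touch away from the marked points**: the trace meets `∂D` at a point at
distance `> ρ` from both marked points. [folklore] -/
def BoundaryTouch (D : DobrushinDomain) (γ : Curve ℂ) (ρ : ℝ) : Prop :=
  ∃ t : I, γ t ∈ frontier D.carrier ∧ ρ < dist (γ t) (D.pt 0) ∧ ρ < dist (γ t) (D.pt 1)

/-- The event "some representative has an exact boundary touch at separation `ρ`". [folklore] -/
def boundaryTouchEvent (D : DobrushinDomain) (ρ : ℝ) : Set (CurveClass ℂ) :=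
  {c | ∃ γ : Curve ℂ, CurveClass.mk γ = c ∧ BoundaryTouch D γ ρ}

/-- An exact boundary touch is an `ε`-near boundary visit for every `ε > 0` (`infDist` vanishes on
the set). [folklore] -/
theorem nearBoundaryVisit_of_boundaryTouch {D : DobrushinDomain} {γ : Curve ℂ} {ρ ε : ℝ} (hε : 0 < ε)
    (h : BoundaryTouch D γ ρ) : NearBoundaryVisit D γ ρ ε := by
  obtain ⟨t, ht, h0, h1⟩ := h
  exact ⟨t, by rwa [infDist_zero_of_mem ht], h0, h1⟩

/-- `boundaryTouchEvent D ρ ⊆ nearBoundaryVisitEvent D ρ ε` for `0 < ε`. [folklore] -/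
theorem boundaryTouchEvent_subset_near {D : DobrushinDomain} {ρ ε : ℝ} (hε : 0 < ε) :
    boundaryTouchEvent D ρ ⊆ nearBoundaryVisitEvent D ρ ε :=
  fun _ ⟨γ, hγ, h⟩ => ⟨γ, hγ, nearBoundaryVisit_of_boundaryTouch hε h⟩

/-- **LIMIT PASSAGE.** Boundary decay at `(D; a_δ, b_δ)` + weak convergence of the critical SAW laws
along `s n → 0⁺` to `ν` ⇒ `ν` gives mass `0` to every exact boundary-touch event (`0 < ρ`): the exact
event lies in the thickened one, which is the image of an OPEN set of curves, so the open-set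
portmanteau bound `ν(G) ≤ limsup_{δ → 0⁺} P_δ(G)` (`Passage.measure_image_mk_le_limsup_law`) and the
decay give `ν (boundaryTouchEvent D ρ) ≤ θ` for every `θ > 0`. [cite: BillingsleyCPM1999, Thm. 2.1] -/
theorem boundaryTouch_null {D : DobrushinDomain} {a b : ℝ → Site 2} {s : ℕ → ℝ}
    {ν : Measure (CurveClass ℂ)} (hBD : BoundaryDecayAt D a b) (hL : IsSubseqLimit D a b s ν)
    {ρ : ℝ} (hρ : 0 < ρ) : ν (boundaryTouchEvent D ρ) = 0 := by
  obtain ⟨hs, hν, hw⟩ := hL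
  haveI := hν
  have hθ : ∀ θ : ℝ, 0 < θ → ν (boundaryTouchEvent D ρ) ≤ ENNReal.ofReal θ := by
    intro θ hθ
    obtain ⟨ε, hε, hev⟩ := hBD ρ θ hρ hθ
    calc ν (boundaryTouchEvent D ρ)
        ≤ ν (nearBoundaryVisitEvent D ρ ε) := measure_mono (boundaryTouchEvent_subset_near hε)
      _ = ν (CurveClass.mk '' {γ | NearBoundaryVisit D γ ρ ε}) := by
          rw [nearBoundaryVisitEvent_eq_image]
      _ ≤ limsup (fun δ : ℝ => SAW.law D.carrier δ (a δ) (b δ)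
            {γ | NearBoundaryVisit D (latticeCurve γ) ρ ε}) (𝓝[>] (0 : ℝ)) :=
          measure_image_mk_le_limsup_law hs hw (isOpen_setOf_nearBoundaryVisit _ _ _)
      _ ≤ ENNReal.ofReal θ := by
          refine limsup_le_of_le (by isBoundedDefault) (hev.mono fun δ hδ => ?_)
          rwa [setOf_nearBoundaryVisit_latticeCurve]
  refine le_antisymm (ENNReal.le_of_forall_pos_le_add fun θ hθ' _ => ?_) zero_le
  rw [zero_add, ← ENNReal.ofReal_coe_nnreal]
  exact hθ θ (NNReal.coe_pos.2 hθ')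

/-! ### Step 3: the closing -/

/-- **CLOSING.** A class outside every exact boundary-touch event with `ρ = 1/(k+1)` meets `∂D` only
at the marked points: a trace point `x ∈ ∂D` other than `D.pt 0`, `D.pt 1` is at positive distance
from both, hence `1/(k+1)`-far from both for large `k`. [folklore] -/
theorem range_inter_frontier_subset_of_forall_notMem (D : DobrushinDomain) (c : CurveClass ℂ)
    (h : ∀ k : ℕ, c ∉ boundaryTouchEvent D (1 / ((k : ℝ) + 1))) :
    c.range ∩ frontier D.carrier ⊆ {D.pt 0, D.pt 1} := by
  obtain ⟨γ, rfl⟩ := CurveClass.surjective_mk c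
  rintro x ⟨hx, hfr⟩
  rw [CurveClass.range_mk] at hx
  obtain ⟨t, rfl⟩ := hx
  by_contra hne
  simp only [mem_insert_iff, mem_singleton_iff, not_or] at hne
  obtain ⟨k, hk⟩ := exists_nat_one_div_lt
    (lt_min (dist_pos.2 hne.1) (dist_pos.2 hne.2))
  refine h k ⟨γ, rfl, t, hfr, ?_, ?_⟩
  · exact hk.trans_le (min_le_left _ _)
  · exact hk.trans_le (min_le_right _ _)

/-- **Every subsequential weak limit with boundary decay meets `∂D` only at the marked points,
a.e.** (the BOUNDARY clause of the crux from the boundary input alone): the countably many exact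
events `boundaryTouchEvent D (1/(k+1))` are `ν`-null (`boundaryTouch_null`) and the closing applies
`ν`-a.e. No SHAPE input. [folklore] -/
theorem ae_boundary_of_boundaryDecayAt {D : DobrushinDomain} {a b : ℝ → Site 2} {s : ℕ → ℝ}
    {ν : Measure (CurveClass ℂ)} (hBD : BoundaryDecayAt D a b) (hL : IsSubseqLimit D a b s ν) :
    ∀ᵐ c ∂ν, c.range ∩ frontier D.carrier ⊆ {D.pt 0, D.pt 1} := by
  have hnull : ∀ᵐ c ∂ν, ∀ k : ℕ, c ∉ boundaryTouchEvent D (1 / ((k : ℝ) + 1)) := by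
    rw [ae_all_iff]
    intro k
    exact measure_eq_zero_iff_ae_notMem.1 (boundaryTouch_null hBD hL (by positivity))
  filter_upwards [hnull] with c hc
  exact range_inter_frontier_subset_of_forall_notMem D c hc

/-- **Registered form (stub `stub_boundaryPassage` of the crux item stmt-CriticalPhenomena-4982).**
Along every endpoint approximation, boundary decay at `(D; a_δ, b_δ)` forces every subsequential weak
limit of the critical SAW laws to meet `∂D` only at the marked points — the BOUNDARY clause of the crux
from the lattice input alone (no SHAPE input). [folklore] -/
theorem stub_boundaryPassage : ∀ (D : DobrushinDomain) (a b : ℝ → Site 2) (s : ℕ → ℝ) (ν : Measure (CurveClass ℂ)), BoundaryDecayAt D a b → IsSubseqLimit D a b s ν → ∀ᵐ c ∂ν, c.range ∩ frontier D.carrier ⊆ {D.pt 0, D.pt 1} :=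
  fun _D _a _b _s _ν hBD hL => ae_boundary_of_boundaryDecayAt hBD hL

end Summit.CriticalPhenomena.SAWScalingLimit.Theorems.SimpleSubseqLimits.Boundary.Passage

end
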